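import Mathlib
import HarnessLib
import Summits.HubbardSuperconductivity.HubbardSuperconductivity.Theorems.KLProgrammeKLRegimeEngineIsoResectorisation
import Summits.HubbardSuperconductivity.HubbardSuperconductivity.Theorems.KLProgrammeKLRegimeEngineTowerImportWt
import Summits.HubbardSuperconductivity.HubbardSuperconductivity.Theorems.KLProgrammeKLRegimeEngineV8IsoMomentRow
import Summits.HubbardSuperconductivity.HubbardSuperconductivity.Theorems.KLProgrammeKLRegimeEngineTowerModelDefsRate
import Literature.MathematicalPhysics.QuantumLattice.SectorisedKernelNormRefinementPlateauPrescribedTreeWt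

/-!
# Route `KLProgramme` — crux K3 ENGINE (stmt-HubbardSuperconductivity-20437 `KLRegimeEngineV17F2`), row (b) `stub_engine_step_norms` (e78dfb33d2f7),
# producer hypothesis `hexI` (`IsoMomFlowAt` / `IsoFirstMomentsAt`): the TREE-WEIGHTED iso(m) ← thin(n₂) per-tuple re-sectorisation and the
# Λ_m-FIRST-MOMENT READER — «hexI-READER-WT» (cell gate-hubbard-kl, seat p3 g24)

WHY.  Row (b) closes BY NAME as `A24a1G14.stub_engine_step_norms_of_E1rows hE₁ hE4 hexI hexG` (p727075); the four hypotheses are E1-class producer rows with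
no supplier.  `hexI` is the iso-moment witness: `IsoFirstMomentsAt L M E d P β U μ n` = the `Λ_m`-WEIGHTED pinned FIRST MOMENTS of the standard isotropic
quartic tuples of `𝒱_n[K_n]` at every resolution `n ≤ m ≤ n_β` (`…EngineV8IsoMomentRow`); before this file nothing in the tree reduced it to anything.  The
UNWEIGHTED iso ← thin single-tuple re-sectorisation is k3c2-p2's `…EngineIsoResectorisation`; the TREE-WEIGHTED plateau-pair lemma is
`Literature…RefinementPlateauPrescribedTreeWt.hubbardSectorPrescribedSumWt_refine_le_split_of_plateau_pair_treeWt` (k3c2-p3's (T3w) call pattern,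
`…AnisoLineFromPlainWt`).  Here the two are combined and the Λ first-moment door of `…EngineE4ScaleDoor` is applied:

* §1 `charSumWt_klIso_bgmFat_le` (weighted iso × fat `≤ 3T` from weighted iso × thin `≤ T`; telescope `klIsoFamily_mul_bgmFatMultiplier_eq_sum`),
  `transferSumsWt_klIso_bgmFat_le` (pair-weighted column/row sums of `E(klIsoFamily m)·S(F̃_{n₂})` `≤ 3T/(βL²)`, any weight rate `j`);
* §2 **`hubbardSectorPinnedSumWt_klIso_of_klAniso_le`** — ANY tree weight `wt`, position map `g`, `n₂ + 1 ≤ m`, any `G`, degree `d + 1`, one iso tuple `σ″`,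
  leg `p`: `ε^d Σ_{x″_p = x} wt(g(x″))‖W_{iso m,σ″}(x″)‖ ≤ c₁^d·c₁r·27^{d+1}·ε^d·(ε·N₁)` from the pair-weighted sums `c₁, c₁r` and the `wt`-weighted THIN per-tuple
  pinned lines `≤ N₁` at leg `p` (children = support overlap with the fat multiplier, `≤ 27` per leg, `card_overlap_klIso_bgmFat_coarse_le`);
* §3 `wtPinnedSum_klIsoKernelAt_le_of_wtAnisoLines` — the instance `wt = klScaleWt L M β j`, `d = 3`, `G = 𝒱_n[K]`, `c₁ = c₁r = 3T/(βL²)`;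
* §4 `klScale_mul_firstMoment_klIsoKernelAt_le_wtPinnedSum` — `Λ_j·(ε³ Σ_y dist(x₁, y_i)·‖W_{iso m,Ω}(x₁ :: y)‖) ≤` the `klScaleWt_j`-weighted pinned sum;
* §5 **THE READER `isoFirstMomentsAt_of_wtAnisoLines`** (`n₂ + 1 ≤ n`): weighted iso(m) × thin(n₂) character sums `≤ T m` at rate `Λ_m` + `klScaleWt_m`-weighted thin
  per-tuple pinned lines of `𝒱_n[K_n]` at index `n₂`, leg `0`, `≤ N₁ m` + the fit `(3·T m/(βL²))⁴·27⁴·ε⁴·N₁ m ≤ cM·|U| + cM′·(P.Klam·U)²` (every `n ≤ m ≤ n_β`)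
  ⟹ `IsoFirstMomentsAt L M cM cM′ P β U μ n`; `…_rate` — the thin lines at the single weight rate `n` (`klScaleWt_le_of_le`);
* §6 **`isoFirstMomentsAt_of_wplainLine_klEng_flow_all`** — in the KL regime (`2 ≤ n`, thin index `n − 1`), under the binders of `charSumWt_klAniso_single_flow_all`:
  the row from the `klScaleWt_n`-weighted PLAIN four-leg pinned line `N₁` of `𝒱_n[K_n]` — VERBATIM the `hplain` input of (T3w)
  `wtTupleLine_le_of_wplainLine_klEng_flow_all` (E-b3/`hE4`) — plus the iso × thin data and the fit with `CW⁴·N₁`.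
So `hexI`'s E1 face is, of record after this file: the SAME weighted plain quartic line that feeds `hE4`, plus ONE geometric datum per resolution (the weighted
iso × thin character sum; unweighted twin `charSum_klIso_single_le_of_padded`/`klIsoT`).  Everything is proved; no definitions; no E1 row is produced; nothing
asserts `hexI`, row (b), any stub of 20437, K3 or superconductivity.
References: BGM 2006 §2.7 (2.66), (2.70)–(2.71a), §2.8 (2.76)–(2.77), (2.82)–(2.84), §3 (3.2)–(3.8) [cite: BenfattoGiulianiMastropietro2006].
-/

noncomputable section

namespace Summit.HubbardSuperconductivity.HubbardSuperconductivity.Theorems.EngineV8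

set_option linter.dupNamespace false -- summit = problem name (single-conjunct summit), D-0017

open Classical
open Real Finset Literature.MathematicalPhysics.QuantumLattice Literature.Probability.LatticeModels GrassmannAlgebra
open Literature.Probability.LatticeModels.BattleFederbush
open Summit.HubbardSuperconductivity.HubbardSuperconductivity.Theorems.KLProgrammeLegKernels
open Summit.HubbardSuperconductivity.HubbardSuperconductivity.Theorems.KLRegimeSplit
open Summit.HubbardSuperconductivity.HubbardSuperconductivity.Theorems.TorusFourierL2
open Summit.HubbardSuperconductivity.HubbardSuperconductivity.Theorems.DispersionFlow

variable {L M : ℕ} [NeZero L] [NeZero M]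

/-! ## §1 Weighted iso × fat from weighted iso × thin; the pair-weighted transfer sums -/

/-- **Weighted iso × fat from weighted iso × thin**: if for every neighbour `a′ ∈ S_{ω₂}` the weighted `ℓ¹` character sum of `klIso m σ · klAniso n₂ a′` is
`≤ T` (any nonnegative weight of the moment form), then that of `klIso m σ · F̃_{n₂,ω₂}` is `≤ 3T` (`n₂ + 1 ≤ m`).
[cite: BenfattoGiulianiMastropietro2006, §2.7 (2.66), (2.71a)] -/
theorem charSumWt_klIso_bgmFat_le {e₀ : ℝ} (he : 0 < e₀) (β μ : ℝ) (K : TrigPolyC4v) {a b : ℝ} (ha : 0 ≤ a) (hb : 0 ≤ b)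
    {m n₂ : ℕ} (hm : n₂ + 1 ≤ m) (σ : Fin (sectorCount (2 * m))) (ω₂ : Fin (sectorCount n₂)) {T : ℝ} (hT0 : 0 ≤ T)
    (hT : ∀ a' : Fin (sectorCount n₂), ∑ z : TorusSite 1 (2 * M) × TorusSite 2 L,
      (1 + a * |(((z.1 0).valMinAbs : ℤ) : ℝ)| + b * |(((z.2 0).valMinAbs : ℤ) : ℝ)| + b * |(((z.2 1).valMinAbs : ℤ) : ℝ)|) *
      ‖∑ q : TorusSite 1 (2 * M) × TorusSite 2 L, (torusChar q.1 z.1 * torusChar q.2 z.2) •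
        (klIsoFamily L M β μ K e₀ m σ (⟨(q.1 0).val, ZMod.val_lt (q.1 0)⟩, q.2) *
          klAnisoFamily L M β μ K e₀ n₂ a' (⟨(q.1 0).val, ZMod.val_lt (q.1 0)⟩, q.2))‖ ≤ T) :
    ∑ z : TorusSite 1 (2 * M) × TorusSite 2 L,
      (1 + a * |(((z.1 0).valMinAbs : ℤ) : ℝ)| + b * |(((z.2 0).valMinAbs : ℤ) : ℝ)| + b * |(((z.2 1).valMinAbs : ℤ) : ℝ)|) *
      ‖∑ q : TorusSite 1 (2 * M) × TorusSite 2 L, (torusChar q.1 z.1 * torusChar q.2 z.2) •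
        (klIsoFamily L M β μ K e₀ m σ (⟨(q.1 0).val, ZMod.val_lt (q.1 0)⟩, q.2) *
          bgmFatMultiplier L M e₀ β (nambuXiCT L μ K) n₂ ω₂ (⟨(q.1 0).val, ZMod.val_lt (q.1 0)⟩, q.2))‖ ≤ 3 * T := by
  set S := (univ : Finset (Fin (sectorCount n₂))).filter (fun a' : Fin (sectorCount n₂) =>
      ∃ δ : ℤ, |δ| ≤ 1 ∧ (sectorCount n₂ : ℤ) ∣ (((a' : ℕ) : ℤ) - ((ω₂ : ℕ) : ℤ) - δ)) with hS
  have hScard : S.card ≤ 3 := card_fatNbrFin_le_three n₂ (ω₂ : ℕ)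
  have hw0 : ∀ z : TorusSite 1 (2 * M) × TorusSite 2 L,
      0 ≤ 1 + a * |(((z.1 0).valMinAbs : ℤ) : ℝ)| + b * |(((z.2 0).valMinAbs : ℤ) : ℝ)| + b * |(((z.2 1).valMinAbs : ℤ) : ℝ)| :=
    fun z => by positivity
  simp_rw [klIsoFamily_mul_bgmFatMultiplier_eq_sum he β μ K hm σ ω₂]
  refine (sum_wt_norm_charSum_sum_le S _ hw0 (fun a' q => klIsoFamily L M β μ K e₀ m σ (⟨(q.1 0).val, ZMod.val_lt (q.1 0)⟩, q.2) *
    klAnisoFamily L M β μ K e₀ n₂ a' (⟨(q.1 0).val, ZMod.val_lt (q.1 0)⟩, q.2))).trans ?_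
  calc _ ≤ ∑ _a ∈ S, T := Finset.sum_le_sum fun a' _ => hT a'
    _ = S.card * T := by rw [Finset.sum_const, nsmul_eq_mul]
    _ ≤ 3 * T := mul_le_mul_of_nonneg_right (by exact_mod_cast hScard) hT0

/-- **The pair-weighted transfer sums of `E(klIsoFamily m)·S(F̃_{n₂})` at weight rate `j`**: from weighted iso(m) × thin(n₂) character sums `≤ T` (moment weight
at scale `j`), both the pair-weighted `x`-sums and `y`-sums of one kernel entry family are `≤ 3T/(βL²)` (`n₂ + 1 ≤ m`). [cite: BenfattoGiulianiMastropietro2006, §2.7 (2.71a)] -/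
theorem transferSumsWt_klIso_bgmFat_le {β : ℝ} (hβ : 0 < β) (μ : ℝ) (K : TrigPolyC4v) {m n₂ : ℕ} (hm : n₂ + 1 ≤ m) (j : ℕ) {T : ℝ} (hT0 : 0 ≤ T)
    (hT : ∀ (σ : Fin (sectorCount (2 * m))) (a' : Fin (sectorCount n₂)), ∑ z : TorusSite 1 (2 * M) × TorusSite 2 L,
      (1 + klScale klE0 j * β / (2 * M) * |(((z.1 0).valMinAbs : ℤ) : ℝ)| + klScale klE0 j * |(((z.2 0).valMinAbs : ℤ) : ℝ)| +
          klScale klE0 j * |(((z.2 1).valMinAbs : ℤ) : ℝ)|) *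
      ‖∑ q : TorusSite 1 (2 * M) × TorusSite 2 L, (torusChar q.1 z.1 * torusChar q.2 z.2) •
        (klIsoFamily L M β μ K klE0 m σ (⟨(q.1 0).val, ZMod.val_lt (q.1 0)⟩, q.2) *
          klAnisoFamily L M β μ K klE0 n₂ a' (⟨(q.1 0).val, ZMod.val_lt (q.1 0)⟩, q.2))‖ ≤ T) :
    (∀ (σ : Fin (sectorCount (2 * m))) (ω' : Fin (sectorCount n₂)) (s c : Fin 2) (y : SpaceTimeIdx L M),
      ∑ x : SpaceTimeIdx L M, ‖(sectorAnalysisMatrix L M β (klIsoFamily L M β μ K klE0 m) *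
          sectorSubMatrix L M β (bgmFatMultiplier L M klE0 β (nambuXiCT L μ K) n₂)) (y, ((σ, s), c)) (x, ((ω', s), c))‖ *
        klScaleWt L M β j {latticeLegPos (2 * (2 * M)) ((y, ((σ, s), c)) : SpaceTimeIdx L M × SectorLeg (sectorCount (2 * m))),
          latticeLegPos (2 * (2 * M)) ((x, ((ω', s), c)) : SpaceTimeIdx L M × SectorLeg (sectorCount n₂))} ≤ 3 * T / (β * (L : ℝ) ^ 2)) ∧
    (∀ (σ : Fin (sectorCount (2 * m))) (ω' : Fin (sectorCount n₂)) (s c : Fin 2) (x : SpaceTimeIdx L M),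
      ∑ y : SpaceTimeIdx L M, ‖(sectorAnalysisMatrix L M β (klIsoFamily L M β μ K klE0 m) *
          sectorSubMatrix L M β (bgmFatMultiplier L M klE0 β (nambuXiCT L μ K) n₂)) (y, ((σ, s), c)) (x, ((ω', s), c))‖ *
        klScaleWt L M β j {latticeLegPos (2 * (2 * M)) ((y, ((σ, s), c)) : SpaceTimeIdx L M × SectorLeg (sectorCount (2 * m))),
          latticeLegPos (2 * (2 * M)) ((x, ((ω', s), c)) : SpaceTimeIdx L M × SectorLeg (sectorCount n₂))} ≤ 3 * T / (β * (L : ℝ) ^ 2)) := by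
  have he : (0 : ℝ) < klE0 := by norm_num [klE0]
  have hΛ : 0 ≤ klScale klE0 j := (klth_klScale_pos j).le
  have hM : (0 : ℝ) < M := Nat.cast_pos.2 (Nat.pos_of_ne_zero (NeZero.ne M))
  exact overlapKernelWt_sums_le_of_charSumWt_le hβ (klIsoFamily L M β μ K klE0 m) (bgmFatMultiplier L M klE0 β (nambuXiCT L μ K) n₂) j
    (T := 3 * T) (fun σ ω₂ => charSumWt_klIso_bgmFat_le he β μ K (by positivity) hΛ hm σ ω₂ hT0 (hT σ))

/-! ## §2 The tree-weighted per-tuple re-sectorisation iso(m) ← thin(n₂) -/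

/-- **Tree-weighted per-tuple re-sectorisation, iso from thin** (BGM 2006 (2.82)–(2.83) with the tree weights of §3 (3.2)–(3.8)): for a tree weight `wt`, a position
map `g`, `n₂ + 1 ≤ m`, every Grassmann polynomial `G`, degree `d + 1`, one ISO label tuple `σ″` of resolution `m`, leg `p` and point `x`:
`ε^d Σ_{x″_p = x} wt(g(x″))·‖W_{iso m,σ″}(x″)‖ ≤ c₁^d · c₁r · 27^{d+1} · ε^d · (ε · N₁)`, given the PAIR-weighted column sums `≤ c₁` and row sums `≤ c₁r` of
`‖E(klIsoFamily … m)·S(F̃_{n₂})‖` (labels matched) and the `wt`-weighted per-tuple pinned lines `≤ N₁` at leg `p` of `G` in `klAnisoFamily … n₂` (EVERY thin label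
tuple, every pin).  The Literature tree-weight plateau-pair lemma on (thin `n₂`, fat `n₂` ; iso `m`) with all legs prescribed, children = support overlap with the fat
multiplier (`≤ 27` per leg). [cite: BenfattoGiulianiMastropietro2006, §2.8 (2.82)-(2.84), §3 (3.2)-(3.8)] -/
theorem hubbardSectorPinnedSumWt_klIso_of_klAniso_le {Λ : Type*} [DecidableEq Λ] {wt : Finset Λ → ℝ} (hwt : IsTreeWeight wt) (g : SpaceTimeIdx L M → Λ)
    {β : ℝ} (hβ : 0 < β) (μ : ℝ) (K : TrigPolyC4v) {e₀ : ℝ} (he : 0 < e₀) {n₂ m : ℕ} (hm : n₂ + 1 ≤ m) (G : HubbardGrassmann L M)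
    {c₁ c₁r N₁ : ℝ} (hc₁0 : 0 ≤ c₁) (hc₁r0 : 0 ≤ c₁r) (hN₁0 : 0 ≤ N₁)
    (hcol₁ : ∀ (σ : Fin (sectorCount (2 * m))) (ω' : Fin (sectorCount n₂)) (s c : Fin 2) (x' : SpaceTimeIdx L M),
      ∑ x'' : SpaceTimeIdx L M, ‖(sectorAnalysisMatrix L M β (klIsoFamily L M β μ K e₀ m) *
        sectorSubMatrix L M β (bgmFatMultiplier L M e₀ β (nambuXiCT L μ K) n₂)) (x'', ((σ, s), c)) (x', ((ω', s), c))‖ * wt {g x'', g x'} ≤ c₁)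
    (hrow₁ : ∀ (σ : Fin (sectorCount (2 * m))) (ω' : Fin (sectorCount n₂)) (s c : Fin 2) (x'' : SpaceTimeIdx L M),
      ∑ x' : SpaceTimeIdx L M, ‖(sectorAnalysisMatrix L M β (klIsoFamily L M β μ K e₀ m) *
        sectorSubMatrix L M β (bgmFatMultiplier L M e₀ β (nambuXiCT L μ K) n₂)) (x'', ((σ, s), c)) (x', ((ω', s), c))‖ * wt {g x'', g x'} ≤ c₁r)
    (d : ℕ) (p : Fin (d + 1))
    (hBF : ∀ (σ' : Fin (d + 1) → SectorLeg (sectorCount n₂)) (y : SpaceTimeIdx L M),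
      imagTimeWeight β M ^ d * ∑ x' ∈ univ.filter (fun x' : Fin (d + 1) → SpaceTimeIdx L M => x' p = y),
        wt ((univ.image x').image g) * ‖sectorisedKernel L M β (klAnisoFamily L M β μ K e₀ n₂) G (d + 1) σ' x'‖ ≤ N₁)
    (σ'' : Fin (d + 1) → SectorLeg (sectorCount (2 * m))) (x : SpaceTimeIdx L M) :
    imagTimeWeight β M ^ d * ∑ x'' ∈ univ.filter (fun x'' : Fin (d + 1) → SpaceTimeIdx L M => x'' p = x),
        wt ((univ.image x'').image g) * ‖sectorisedKernel L M β (klIsoFamily L M β μ K e₀ m) G (d + 1) σ'' x''‖ ≤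
      c₁ ^ d * c₁r * 27 ^ (d + 1) * imagTimeWeight β M ^ d * (imagTimeWeight β M * N₁) := by
  set F' := klIsoFamily L M β μ K e₀ m with hF'
  set F := klAnisoFamily L M β μ K e₀ n₂ with hF
  set Ft := bgmFatMultiplier L M e₀ β (nambuXiCT L μ K) n₂ with hFt
  -- the per-pair position sums for arbitrary label pairs: mismatched spin/charge entries vanish
  have hcol₁' : ∀ (ℓ'' : SectorLeg (sectorCount (2 * m))) (X' : SpaceTimeIdx L M × SectorLeg (sectorCount n₂)),
      ∑ x'' : SpaceTimeIdx L M, ‖(sectorAnalysisMatrix L M β F' * sectorSubMatrix L M β Ft) (x'', ℓ'') X'‖ * wt {g x'', g X'.1} ≤ c₁ := by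
    rintro ⟨⟨ω'', σ''⟩, c''⟩ ⟨x', ⟨ω', σ'⟩, c'⟩
    by_cases hlab : σ' = σ'' ∧ c' = c''
    · obtain ⟨rfl, rfl⟩ := hlab
      exact hcol₁ ω'' ω' σ' c' x'
    · refine le_of_eq_of_le (sum_eq_zero fun x'' _ => ?_) hc₁0
      rw [sectorAnalysis_mul_sectorSub_apply, if_neg (by exact hlab), norm_zero, zero_mul]
  have hrow₁' : ∀ (X'' : SpaceTimeIdx L M × SectorLeg (sectorCount (2 * m))) (ℓ' : SectorLeg (sectorCount n₂)),
      ∑ x' : SpaceTimeIdx L M, ‖(sectorAnalysisMatrix L M β F' * sectorSubMatrix L M β Ft) X'' (x', ℓ')‖ * wt {g X''.1, g x'} ≤ c₁r := by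
    rintro ⟨x'', ⟨ω'', σ''⟩, c''⟩ ⟨⟨ω', σ'⟩, c'⟩
    by_cases hlab : σ' = σ'' ∧ c' = c''
    · obtain ⟨rfl, rfl⟩ := hlab
      exact hrow₁ ω'' ω' σ' c' x''
    · refine le_of_eq_of_le (sum_eq_zero fun x' _ => ?_) hc₁r0
      rw [sectorAnalysis_mul_sectorSub_apply, if_neg (by exact hlab), norm_zero, zero_mul]
  -- children: support overlap with the fat multiplier; at most 27 coarse labels per fine label (matched spin/charge)
  have hρ : ∀ ℓ'' : SectorLeg (sectorCount (2 * m)),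
      (((univ.filter fun ℓ' : SectorLeg (sectorCount n₂) =>
          (∃ q : FreqMomentum L M, F' ℓ''.1.1 q ≠ 0 ∧ Ft ℓ'.1.1 q ≠ 0) ∧ ℓ'.1.2 = ℓ''.1.2 ∧ ℓ'.2 = ℓ''.2).card : ℝ)) ≤ 27 := by
    intro ℓ''
    have h27 := card_overlap_klIso_bgmFat_coarse_le (L := L) (M := M) he β μ K (show n₂ ≤ 2 * m by omega) ℓ''.1.1
    have hle : (univ.filter fun ℓ' : SectorLeg (sectorCount n₂) =>
          (∃ q : FreqMomentum L M, F' ℓ''.1.1 q ≠ 0 ∧ Ft ℓ'.1.1 q ≠ 0) ∧ ℓ'.1.2 = ℓ''.1.2 ∧ ℓ'.2 = ℓ''.2).card ≤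
        ((univ : Finset (Fin (sectorCount n₂))).filter (fun ω₂ : Fin (sectorCount n₂) =>
          ∃ q : FreqMomentum L M, klIsoFamily L M β μ K e₀ m ℓ''.1.1 q ≠ 0 ∧
            bgmFatMultiplier L M e₀ β (nambuXiCT L μ K) n₂ ω₂ q ≠ 0)).card := by
      refine Finset.card_le_card_of_injOn (fun ℓ' : SectorLeg (sectorCount n₂) => ℓ'.1.1) (fun ℓ' hℓ' => ?_)
        (fun ℓ₁ h₁ ℓ₂ h₂ heq => ?_)
      · simp only [mem_coe, mem_filter, mem_univ, true_and] at hℓ' ⊢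
        exact hℓ'.1
      · simp only [mem_coe, mem_filter, mem_univ, true_and] at h₁ h₂
        exact Prod.ext (Prod.ext heq (h₁.2.1.trans h₂.2.1.symm)) (h₁.2.2.trans h₂.2.2.symm)
    exact_mod_cast hle.trans h27
  -- the coarse prescribed sums with ALL legs prescribed: the single string `τ′`
  have hfiltE : ∀ {Ns : ℕ} (τ' : Fin (d + 1) → SectorLeg Ns) (A : Finset (Fin (d + 1) → SectorLeg Ns)), τ' ∈ A →
      A.filter (fun σ' : Fin (d + 1) → SectorLeg Ns => ∀ e ∈ (univ : Finset (Fin (d + 1))), σ' e = τ' e) = {τ'} := by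
    intro Ns τ' A hA
    ext σ'
    simp only [mem_filter, mem_univ, true_implies, mem_singleton]
    constructor
    · rintro ⟨-, h⟩; exact funext h
    · rintro rfl; exact ⟨hA, fun _ => rfl⟩
  have hN₁' : ∀ (τ' : Fin (d + 1) → SectorLeg (sectorCount n₂)) (y : SpaceTimeIdx L M),
      imagTimeWeight β M ^ d *
        ∑ σ' ∈ univ.filter (fun σ' : Fin (d + 1) → SectorLeg (sectorCount n₂) => ∀ e ∈ (univ : Finset (Fin (d + 1))), σ' e = τ' e),
          ∑ x' ∈ univ.filter (fun x' : Fin (d + 1) → SpaceTimeIdx L M => x' p = y),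
            wt ((univ.image x').image g) * ‖sectorisedKernel L M β F G (d + 1) σ' x'‖ ≤ N₁ := by
    intro τ' y
    rw [hfiltE τ' univ (mem_univ _), sum_singleton]
    exact hBF τ' y
  have hN₂' : ∀ (τ' : Fin (d + 1) → SectorLeg (sectorCount n₂)) (y : SpaceTimeIdx L M),
      imagTimeWeight β M ^ d *
        ∑ σ' ∈ (∅ : Finset (Fin (d + 1) → SectorLeg (sectorCount n₂))).filter
            (fun σ' : Fin (d + 1) → SectorLeg (sectorCount n₂) => ∀ e ∈ (univ : Finset (Fin (d + 1))), σ' e = τ' e),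
          ∑ x' ∈ univ.filter (fun x' : Fin (d + 1) → SpaceTimeIdx L M => x' p = y),
            wt ((univ.image x').image g) * ‖sectorisedKernel L M β F G (d + 1) σ' x'‖ ≤ 0 := fun τ' y => by simp
  have h := hubbardSectorPrescribedSumWt_refine_le_split_of_plateau_pair_treeWt hwt g hβ F Ft
    (fun ω q => bgmFatMultiplier_mul_bgmMultiplier he β (nambuXiCT L μ K) n₂ ω q)
    (fun q hq ω => klAnisoFamily_eq_zero_of_sum_eq_zero β μ K e₀ n₂ q hq ω) F'
    (fun ω' q hne => sum_klAnisoFamily_eq_one_of_klIsoFamily_ne_zero he β μ K hm ω' q hne) G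
    (fun ω'' ω' => ∃ q : FreqMomentum L M, F' ω'' q ≠ 0 ∧ Ft ω' q ≠ 0)
    (fun ω'' ω' hno q => by by_contra hq; exact hno ⟨q, (mul_ne_zero_iff.1 hq).1, (mul_ne_zero_iff.1 hq).2⟩)
    hc₁0 hc₁r0 zero_le_one le_rfl hN₁0 le_rfl hcol₁' hrow₁' hρ
    d {σ''} ∅ univ σ'' p (mem_univ p)
    (fun σ' _ => le_trans (by exact_mod_cast (card_filter_le _ _).trans (card_singleton σ'').le) (le_of_eq Nat.cast_one))
    (fun σ' hσ' => absurd hσ' (Finset.notMem_empty _)) hN₁' hN₂' x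
  rw [hfiltE σ'' {σ''} (mem_singleton_self σ''), sum_singleton] at h
  refine h.trans (le_of_eq ?_)
  rw [card_univ, Fintype.card_fin]
  ring

/-! ## §3 The instance on the scale-`n` quartic kernel: `klScaleWt_j` weights, `G = 𝒱_n[K]`, pair sums from the weighted iso × thin character sums -/

/-- **The `klScaleWt_j`-weighted pinned size of ONE iso tuple of `𝒱_n[K]` from the weighted thin per-tuple lines** (`n₂ + 1 ≤ m`, four legs, leg `0` pinned):
`ε³·Σ_{x″_0 = x₁} klScaleWt_j(pos x″)·‖klIsoKernelAt … K n m Ω x″‖ ≤ (3T/(βL²))³·(3T/(βL²))·27⁴·ε³·(ε·N₁)`, given the weighted iso(m) × thin(n₂) character sums `≤ T`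
at rate `Λ_j` and the `klScaleWt_j`-weighted pinned lines `≤ N₁` (leg `0`) of EVERY thin label tuple of index `n₂` of `klAnisoKernelAt … K n n₂`.
[cite: BenfattoGiulianiMastropietro2006, §2.7 (2.71a), §2.8 (2.82)-(2.84), §3 (3.2)-(3.8)] -/
theorem wtPinnedSum_klIsoKernelAt_le_of_wtAnisoLines {β : ℝ} (hβ : 0 < β) (U μ : ℝ) (K : TrigPolyC4v) (n : ℕ) {n₂ m : ℕ} (hm : n₂ + 1 ≤ m) (j : ℕ)
    {T N₁ : ℝ} (hT0 : 0 ≤ T) (hN₁0 : 0 ≤ N₁)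
    (hT : ∀ (σ : Fin (sectorCount (2 * m))) (a' : Fin (sectorCount n₂)), ∑ z : TorusSite 1 (2 * M) × TorusSite 2 L,
      (1 + klScale klE0 j * β / (2 * M) * |(((z.1 0).valMinAbs : ℤ) : ℝ)| + klScale klE0 j * |(((z.2 0).valMinAbs : ℤ) : ℝ)| +
          klScale klE0 j * |(((z.2 1).valMinAbs : ℤ) : ℝ)|) *
      ‖∑ q : TorusSite 1 (2 * M) × TorusSite 2 L, (torusChar q.1 z.1 * torusChar q.2 z.2) •
        (klIsoFamily L M β μ K klE0 m σ (⟨(q.1 0).val, ZMod.val_lt (q.1 0)⟩, q.2) *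
          klAnisoFamily L M β μ K klE0 n₂ a' (⟨(q.1 0).val, ZMod.val_lt (q.1 0)⟩, q.2))‖ ≤ T)
    (hBF : ∀ (σ' : Fin 4 → SectorLeg (sectorCount n₂)) (y : SpaceTimeIdx L M),
      imagTimeWeight β M ^ 3 * ∑ x' ∈ univ.filter (fun x' : Fin 4 → SpaceTimeIdx L M => x' 0 = y),
        klScaleWt L M β j ((univ.image x').image (fun x : SpaceTimeIdx L M => (((((2 * (x.1 : ℕ) : ℕ)) : ZMod (2 * (2 * M)))), x.2))) *
          ‖klAnisoKernelAt L M β U μ K n n₂ σ' x'‖ ≤ N₁)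
    (Ω : Fin 4 → SectorLeg (sectorCount (2 * m))) (x₁ : SpaceTimeIdx L M) :
    imagTimeWeight β M ^ 3 * ∑ x'' ∈ univ.filter (fun x'' : Fin 4 → SpaceTimeIdx L M => x'' 0 = x₁),
        klScaleWt L M β j ((univ.image x'').image (fun x : SpaceTimeIdx L M => (((((2 * (x.1 : ℕ) : ℕ)) : ZMod (2 * (2 * M)))), x.2))) *
          ‖klIsoKernelAt L M β U μ K n m Ω x''‖ ≤
      (3 * T / (β * (L : ℝ) ^ 2)) ^ 3 * (3 * T / (β * (L : ℝ) ^ 2)) * 27 ^ 4 * imagTimeWeight β M ^ 3 * (imagTimeWeight β M * N₁) := by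
  have he : (0 : ℝ) < klE0 := by norm_num [klE0]
  have hL : (0 : ℝ) < L := Nat.cast_pos.2 (Nat.pos_of_ne_zero (NeZero.ne L))
  have hc0 : 0 ≤ 3 * T / (β * (L : ℝ) ^ 2) := by positivity
  obtain ⟨hxS, hyS⟩ := transferSumsWt_klIso_bgmFat_le hβ μ K hm j hT0 hT
  have hwt : IsTreeWeight (klScaleWt L M β j) := isTreeWeight_klScaleWt L M hβ.le j
  exact hubbardSectorPinnedSumWt_klIso_of_klAniso_le hwt
    (fun x : SpaceTimeIdx L M => (((((2 * (x.1 : ℕ) : ℕ)) : ZMod (2 * (2 * M)))), x.2)) hβ μ K he hm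
    (klEffectiveAction L M β U μ K klE0 n) hc0 hc0 hN₁0 (fun σ ω' s c x' => hyS σ ω' s c x') (fun σ ω' s c x'' => hxS σ ω' s c x'') 3 0
    (fun σ' y => hBF σ' y) Ω x₁

/-! ## §4 The Λ_j first-moment door on one iso tuple -/

omit [NeZero L] in
/-- **Scaled pinned first moments are dominated by the weighted pinned sum** (any resolution `m`, any weight rate `j`, any leg `i` of the three summed ones):
`Λ_j·(ε³ Σ_y dist(x₁, y_i)·‖klIsoKernelAt … K n m Ω (x₁ :: y)‖) ≤ ε³ Σ_{x″_0 = x₁} klScaleWt_j(pos x″)·‖klIsoKernelAt … K n m Ω x″‖`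
(`klScale_mul_spaceTimeDist_le_klScaleWt_image_sub_one`; `0 ≤ β`). [folklore] -/
theorem klScale_mul_firstMoment_klIsoKernelAt_le_wtPinnedSum [NeZero L] {β : ℝ} (hβ : 0 ≤ β) (U μ : ℝ) (K : TrigPolyC4v) (n m j : ℕ)
    (Ω : Fin 4 → SectorLeg (sectorCount (2 * m))) (x₁ : SpaceTimeIdx L M) (i : Fin 3) :
    klScale klE0 j * (imagTimeWeight β M ^ 3 * ∑ y : Fin 3 → SpaceTimeIdx L M,
      KLRegimeSplit.spaceTimeDist L M β x₁ (y i) * ‖klIsoKernelAt L M β U μ K n m Ω (Matrix.vecCons x₁ y)‖) ≤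
    imagTimeWeight β M ^ 3 * ∑ x'' ∈ univ.filter (fun x'' : Fin 4 → SpaceTimeIdx L M => x'' 0 = x₁),
        klScaleWt L M β j ((univ.image x'').image (fun x : SpaceTimeIdx L M => (((((2 * (x.1 : ℕ) : ℕ)) : ZMod (2 * (2 * M)))), x.2))) *
          ‖klIsoKernelAt L M β U μ K n m Ω x''‖ := by
  have hε : 0 ≤ imagTimeWeight β M := imagTimeWeight_nonneg hβ M
  rw [sum_filter_apply_eq, mul_left_comm]
  refine mul_le_mul_of_nonneg_left ?_ (pow_nonneg hε 3)
  rw [mul_sum]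
  refine sum_le_sum fun y _ => ?_
  rw [Fin.insertNth_zero', ← mul_assoc]
  refine mul_le_mul_of_nonneg_right ?_ (norm_nonneg _)
  -- the scaled distance `Λ_j·dist(x₁, y_i)` against the tree weight of the tuple `(x₁ :: y, Ω)`
  have h := klScale_mul_spaceTimeDist_le_klScaleWt_image_sub_one (L := L) (M := M) hβ j
    (fun k : Fin 4 => ((Fin.cons x₁ y : Fin 4 → SpaceTimeIdx L M) k, Ω k)) 0 i.succ
  rw [image_latticeLegPos_eq_image_pos] at h
  have h1 := one_le_klScaleWt L M β j
    ((univ.image fun k : Fin 4 => (Fin.cons x₁ y : Fin 4 → SpaceTimeIdx L M) k).image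
      (fun x : SpaceTimeIdx L M => (((((2 * (x.1 : ℕ) : ℕ)) : ZMod (2 * (2 * M)))), x.2)))
  simp only [Fin.cons_zero, Fin.cons_succ] at h
  have e : (univ.image fun k : Fin 4 => (Fin.cons x₁ y : Fin 4 → SpaceTimeIdx L M) k) = univ.image (Fin.cons x₁ y : Fin 4 → SpaceTimeIdx L M) := rfl
  rw [e] at h h1
  linarith

/-! ## §5 THE READER: `IsoFirstMomentsAt` from weighted thin per-tuple lines and the weighted iso × thin character sums -/

/-- **`hexI`'s ROW FROM WEIGHTED THIN PER-TUPLE LINES** (reader; `n₂ + 1 ≤ n`): if at every resolution `n ≤ m ≤ n_β` (1) the weighted iso(m) × thin(n₂) character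
sums at rate `Λ_m` in the flow frame `K_n` are `≤ T m` and (2) the `klScaleWt_m`-weighted pinned lines (leg `0`) of EVERY thin label tuple of index `n₂` of the scale-`n`
quartic kernel `klAnisoKernelAt … (K_n) n n₂` are `≤ N₁ m`, and (3) `(3·T m/(βL²))⁴·27⁴·ε⁴·N₁ m ≤ cM·|U| + cM′·(P.Klam·U)²`, then
`IsoFirstMomentsAt L M cM cM′ P β U μ n`. [cite: BenfattoGiulianiMastropietro2006, §2.7 (2.70)-(2.71a), §2.8 (2.82)-(2.84), §3 (3.5)-(3.6)] -/
theorem isoFirstMomentsAt_of_wtAnisoLines {β : ℝ} (hβ : 0 < β) (U μ : ℝ) (P : SplitConsts) (n : ℕ) {n₂ : ℕ} (hn : n₂ + 1 ≤ n)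
    {T N₁ : ℕ → ℝ} (hT0 : ∀ m, 0 ≤ T m) (hN₁0 : ∀ m, 0 ≤ N₁ m) {cM cM' : ℝ}
    (hT : ∀ m, n ≤ m → m ≤ nScales β → ∀ (σ : Fin (sectorCount (2 * m))) (a' : Fin (sectorCount n₂)), ∑ z : TorusSite 1 (2 * M) × TorusSite 2 L,
      (1 + klScale klE0 m * β / (2 * M) * |(((z.1 0).valMinAbs : ℤ) : ℝ)| + klScale klE0 m * |(((z.2 0).valMinAbs : ℤ) : ℝ)| +
          klScale klE0 m * |(((z.2 1).valMinAbs : ℤ) : ℝ)|) *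
      ‖∑ q : TorusSite 1 (2 * M) × TorusSite 2 L, (torusChar q.1 z.1 * torusChar q.2 z.2) •
        (klIsoFamily L M β μ (klFlowFrameU L M β U μ n) klE0 m σ (⟨(q.1 0).val, ZMod.val_lt (q.1 0)⟩, q.2) *
          klAnisoFamily L M β μ (klFlowFrameU L M β U μ n) klE0 n₂ a' (⟨(q.1 0).val, ZMod.val_lt (q.1 0)⟩, q.2))‖ ≤ T m)
    (hBF : ∀ m, n ≤ m → m ≤ nScales β → ∀ (σ' : Fin 4 → SectorLeg (sectorCount n₂)) (y : SpaceTimeIdx L M),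
      imagTimeWeight β M ^ 3 * ∑ x' ∈ univ.filter (fun x' : Fin 4 → SpaceTimeIdx L M => x' 0 = y),
        klScaleWt L M β m ((univ.image x').image (fun x : SpaceTimeIdx L M => (((((2 * (x.1 : ℕ) : ℕ)) : ZMod (2 * (2 * M)))), x.2))) *
          ‖klAnisoKernelAt L M β U μ (klFlowFrameU L M β U μ n) n n₂ σ' x'‖ ≤ N₁ m)
    (hfit : ∀ m, n ≤ m → m ≤ nScales β →
      (3 * T m / (β * (L : ℝ) ^ 2)) ^ 3 * (3 * T m / (β * (L : ℝ) ^ 2)) * 27 ^ 4 * imagTimeWeight β M ^ 3 * (imagTimeWeight β M * N₁ m) ≤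
        cM * |U| + cM' * (P.Klam * U) ^ 2) :
    IsoFirstMomentsAt L M cM cM' P β U μ n := by
  intro m hnm hm ω x₁ i
  have hm' : n₂ + 1 ≤ m := hn.trans hnm
  exact ((klScale_mul_firstMoment_klIsoKernelAt_le_wtPinnedSum hβ.le U μ (klFlowFrameU L M β U μ n) n m m _ x₁ i).trans
    (wtPinnedSum_klIsoKernelAt_le_of_wtAnisoLines hβ U μ (klFlowFrameU L M β U μ n) n hm' m (hT0 m) (hN₁0 m) (hT m hnm hm) (hBF m hnm hm) _ x₁)).trans
    (hfit m hnm hm)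

/-- **The same with the thin lines asked at the single weight rate `n`** (rate `m ≥ n` is weaker: `klScaleWt_m ≤ klScaleWt_n`, `klScaleWt_le_of_le`).
[cite: BenfattoGiulianiMastropietro2006, §2.7 (2.70)-(2.71a), §2.8 (2.82)-(2.84), §3 (3.5)-(3.6)] -/
theorem isoFirstMomentsAt_of_wtAnisoLines_rate {β : ℝ} (hβ : 0 < β) (U μ : ℝ) (P : SplitConsts) (n : ℕ) {n₂ : ℕ} (hn : n₂ + 1 ≤ n)
    {T : ℕ → ℝ} {N₁ : ℝ} (hT0 : ∀ m, 0 ≤ T m) (hN₁0 : 0 ≤ N₁) {cM cM' : ℝ}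
    (hT : ∀ m, n ≤ m → m ≤ nScales β → ∀ (σ : Fin (sectorCount (2 * m))) (a' : Fin (sectorCount n₂)), ∑ z : TorusSite 1 (2 * M) × TorusSite 2 L,
      (1 + klScale klE0 m * β / (2 * M) * |(((z.1 0).valMinAbs : ℤ) : ℝ)| + klScale klE0 m * |(((z.2 0).valMinAbs : ℤ) : ℝ)| +
          klScale klE0 m * |(((z.2 1).valMinAbs : ℤ) : ℝ)|) *
      ‖∑ q : TorusSite 1 (2 * M) × TorusSite 2 L, (torusChar q.1 z.1 * torusChar q.2 z.2) •
        (klIsoFamily L M β μ (klFlowFrameU L M β U μ n) klE0 m σ (⟨(q.1 0).val, ZMod.val_lt (q.1 0)⟩, q.2) *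
          klAnisoFamily L M β μ (klFlowFrameU L M β U μ n) klE0 n₂ a' (⟨(q.1 0).val, ZMod.val_lt (q.1 0)⟩, q.2))‖ ≤ T m)
    (hBF : ∀ (σ' : Fin 4 → SectorLeg (sectorCount n₂)) (y : SpaceTimeIdx L M),
      imagTimeWeight β M ^ 3 * ∑ x' ∈ univ.filter (fun x' : Fin 4 → SpaceTimeIdx L M => x' 0 = y),
        klScaleWt L M β n ((univ.image x').image (fun x : SpaceTimeIdx L M => (((((2 * (x.1 : ℕ) : ℕ)) : ZMod (2 * (2 * M)))), x.2))) *
          ‖klAnisoKernelAt L M β U μ (klFlowFrameU L M β U μ n) n n₂ σ' x'‖ ≤ N₁)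
    (hfit : ∀ m, n ≤ m → m ≤ nScales β →
      (3 * T m / (β * (L : ℝ) ^ 2)) ^ 3 * (3 * T m / (β * (L : ℝ) ^ 2)) * 27 ^ 4 * imagTimeWeight β M ^ 3 * (imagTimeWeight β M * N₁) ≤
        cM * |U| + cM' * (P.Klam * U) ^ 2) :
    IsoFirstMomentsAt L M cM cM' P β U μ n := by
  have hε : 0 ≤ imagTimeWeight β M := imagTimeWeight_nonneg hβ.le M
  refine isoFirstMomentsAt_of_wtAnisoLines hβ U μ P n hn hT0 (fun _ => hN₁0) hT (fun m hnm _ σ' y => ?_) hfit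
  refine le_trans (mul_le_mul_of_nonneg_left (sum_le_sum fun x' _ => ?_) (pow_nonneg hε 3)) (hBF σ' y)
  exact mul_le_mul_of_nonneg_right (klScaleWt_le_of_le β hnm _) (norm_nonneg _)

/-! ## §6 In the KL regime: `hexI`'s row from the weighted PLAIN four-leg line — the input of (T3w) `wtTupleLine_le_of_wplainLine_klEng_flow_all` — and the iso × thin data -/

/-- **`IsoFirstMomentsAt` FROM THE WEIGHTED PLAIN FOUR-LEG LINE AT THE FLOW FRAME** (`2 ≤ n`; thin index `n − 1`): `∃ CW > 0` (`CW = CT/2`, `CT` of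
`charSumWt_klAniso_single_flow_all`) such that, under that theorem's binders, for every `N₁ ≥ 0` bounding the `klScaleWt_n`-weighted PLAIN four-leg pinned sums of
`𝒱_n[K_n]` at leg `0` (VERBATIM the `hplain` hypothesis of (T3w) — the E-b3/`hE4` input), every `T m ≥ 0` bounding the weighted iso(m) × thin(n−1) character sums
at rate `Λ_m` (`n ≤ m ≤ n_β`), and every `cM, cM′` with `(3·T m/(βL²))⁴·27⁴·ε⁴·(CW⁴·N₁) ≤ cM·|U| + cM′·(P.Klam·U)²`: `IsoFirstMomentsAt L M cM cM′ P β U μ n`.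
ONE weighted plain quartic line of `𝒱_n[K_n]` serves BOTH `hE4` (via (T3w)) and `hexI` (here), modulo the iso × thin multiplier data.  (The case `n = 1` — thin
index `0`, the scale-`0` family's weighted single sum — is not in this file.) [cite: BenfattoGiulianiMastropietro2006, §2.7 (2.70)-(2.71a), §2.8 (2.76)-(2.84), §3 (3.5)-(3.6)] -/
theorem isoFirstMomentsAt_of_wplainLine_klEng_flow_all (R : RenConsts) (c'' : ℝ) (hc'' : 0 ≤ c'') :
    ∃ CW : ℝ, 0 < CW ∧
      ∀ (G : GeoConsts) (P : SplitConsts) (Q : EngConsts) (cc : ℝ), R.WF2 → 0 < cc → cc ≤ klEngC₃6 P R →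
      ∀ μ ∈ klWindowC, ∀ U : ℝ, 0 < U → U ≤ min (klEngU₀3 P R cc) (1 / (R.Gfr 3 + 1)) → c'' * U ≤ 1 →
      ∀ β : ℝ, klBetaMin ≤ β → β ≤ Real.exp (cc / U ^ 2) →
      ∀ (L M : ℕ) [NeZero L] [NeZero M], klEngL₃ β U ≤ L → klEngM₃ β U L ≤ M →
      ∀ n : ℕ, 2 ≤ n → n ≤ nScales β + 1 → IsKLRegime U cc (-(n : ℤ)) → HistP klPredsV17F2 L M G P Q R β U μ 0 n →
        (∀ m', 1 ≤ m' → m' < n → FlowPieceOscAt L M c'' β U μ m') →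
        ∀ N₁ : ℝ, 0 ≤ N₁ →
          (∀ (τ' : Fin 4 → SectorLeg 1) (y : SpaceTimeIdx L M),
            imagTimeWeight β M ^ 3 * ∑ x' ∈ univ.filter (fun x' : Fin 4 → SpaceTimeIdx L M => x' 0 = y),
              klScaleWt L M β n ((univ.image x').image (fun x : SpaceTimeIdx L M => (((((2 * (x.1 : ℕ) : ℕ)) : ZMod (2 * (2 * M)))), x.2))) *
                ‖sectorisedKernel L M β (trivialMultiplier L M)
                  (klEffectiveAction L M β U μ (klFlowFrameU L M β U μ n) klE0 n) 4 τ' x'‖ ≤ N₁) →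
          ∀ T : ℕ → ℝ, (∀ m, 0 ≤ T m) →
          (∀ m, n ≤ m → m ≤ nScales β → ∀ (σ : Fin (sectorCount (2 * m))) (a' : Fin (sectorCount (n - 1))),
            ∑ z : TorusSite 1 (2 * M) × TorusSite 2 L,
              (1 + klScale klE0 m * β / (2 * M) * |(((z.1 0).valMinAbs : ℤ) : ℝ)| + klScale klE0 m * |(((z.2 0).valMinAbs : ℤ) : ℝ)| +
                  klScale klE0 m * |(((z.2 1).valMinAbs : ℤ) : ℝ)|) *
              ‖∑ q : TorusSite 1 (2 * M) × TorusSite 2 L, (torusChar q.1 z.1 * torusChar q.2 z.2) •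
                (klIsoFamily L M β μ (klFlowFrameU L M β U μ n) klE0 m σ (⟨(q.1 0).val, ZMod.val_lt (q.1 0)⟩, q.2) *
                  klAnisoFamily L M β μ (klFlowFrameU L M β U μ n) klE0 (n - 1) a' (⟨(q.1 0).val, ZMod.val_lt (q.1 0)⟩, q.2))‖ ≤ T m) →
          ∀ cM cM' : ℝ,
          (∀ m, n ≤ m → m ≤ nScales β →
            (3 * T m / (β * (L : ℝ) ^ 2)) ^ 3 * (3 * T m / (β * (L : ℝ) ^ 2)) * 27 ^ 4 * imagTimeWeight β M ^ 3 *
              (imagTimeWeight β M * (CW ^ 4 * N₁)) ≤ cM * |U| + cM' * (P.Klam * U) ^ 2) →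
            IsoFirstMomentsAt L M cM cM' P β U μ n := by
  obtain ⟨CT, hCT, hT⟩ := charSumWt_klAniso_single_flow_all R c'' hc''
  refine ⟨CT / 2, by positivity, ?_⟩
  intro G P Q cc hR2 hcc hcc6 μ hμ U hU hUle hcU β hβmin hβc L M _ _ hL3 hM3 n hn2 hnN hreg hhist hosc N₁ hN₁0 hplain Tm hTm0 hiso cM cM' hfit
  have hn1 : 1 ≤ n := le_trans (by norm_num) hn2
  have hβ0 : 0 < β := KLRegimeSplit.pos_of_klBetaMin_le hβmin
  have hM0 : (0 : ℝ) < M := Nat.cast_pos.2 (Nat.pos_of_ne_zero (NeZero.ne M))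
  have hL0 : (0 : ℝ) < L := Nat.cast_pos.2 (Nat.pos_of_ne_zero (NeZero.ne L))
  set K : TrigPolyC4v := klFlowFrameU L M β U μ n with hK
  set 𝒱 : HubbardGrassmann L M := klEffectiveAction L M β U μ K klE0 n with h𝒱
  set gpos : SpaceTimeIdx L M → ZMod (2 * (2 * M)) × TorusSite 2 L :=
    fun x => (((((2 * (x.1 : ℕ) : ℕ)) : ZMod (2 * (2 * M)))), x.2) with hgpos
  -- the weighted single-multiplier character sums of the THIN family of index `n − 1`, rate `n`, at the flow frame
  have hT₁ := fun ω => hT G P Q cc hR2 hcc hcc6 μ hμ U hU hUle hcU β hβmin hβc L M hL3 hM3 n hn1 hnN hreg hhist hosc (n - 1) n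
    (by omega) (Nat.sub_le n 1) (Nat.sub_le n 1) ω
  have hc0 : 0 ≤ CT * M * (L : ℝ) ^ 2 / (β * (L : ℝ) ^ 2) := by positivity
  obtain ⟨hrowS, hcolS⟩ := transferSumsWt_klAniso_single_le hβ0 μ K (n - 1) n hT₁
  have hwt : IsTreeWeight (klScaleWt L M β n) := isTreeWeight_klScaleWt L M hβ0.le n
  have hq : CT * M * (L : ℝ) ^ 2 / (β * (L : ℝ) ^ 2) * imagTimeWeight β M = CT / 2 := by
    unfold imagTimeWeight
    field_simp
  -- the `klScaleWt_n`-weighted thin per-tuple pinned lines (index `n − 1`, leg `0`) of `𝒱_n[K_n]` from the weighted plain line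
  have hBF : ∀ (σ' : Fin 4 → SectorLeg (sectorCount (n - 1))) (y : SpaceTimeIdx L M),
      imagTimeWeight β M ^ 3 * ∑ x' ∈ univ.filter (fun x' : Fin 4 → SpaceTimeIdx L M => x' 0 = y),
        klScaleWt L M β n ((univ.image x').image gpos) * ‖klAnisoKernelAt L M β U μ K n (n - 1) σ' x'‖ ≤ (CT / 2) ^ 4 * N₁ := by
    intro σ' y
    have hline := wprescribedSum_klAniso_le_of_plain_treeWt hwt gpos hβ0 μ K (n - 1) 𝒱 hc0 hc0 hN₁0
      (fun ω'' s c x' => hcolS ω'' s c x') (fun ω'' s c x'' => hrowS ω'' s c x'') 3 σ' 0 hplain y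
    refine hline.trans (le_of_eq ?_)
    calc (CT * M * (L : ℝ) ^ 2 / (β * (L : ℝ) ^ 2)) ^ 3 * (CT * M * (L : ℝ) ^ 2 / (β * (L : ℝ) ^ 2)) * imagTimeWeight β M ^ (3 + 1) * N₁
        = (CT * M * (L : ℝ) ^ 2 / (β * (L : ℝ) ^ 2) * imagTimeWeight β M) ^ 4 * N₁ := by ring
      _ = (CT / 2) ^ 4 * N₁ := by rw [hq]
  exact isoFirstMomentsAt_of_wtAnisoLines_rate hβ0 U μ P n (n₂ := n - 1) (by omega) hTm0 (by positivity) hiso hBF hfit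

end Summit.HubbardSuperconductivity.HubbardSuperconductivity.Theorems.EngineV8

end
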